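import Mathlib.Topology.Algebra.Valued.ValuationTopology
import Mathlib.Algebra.Order.GroupWithZero.Canonical
import Mathlib.Algebra.Ring.GeomSum
import Mathlib.Data.Int.GCD
import HarnessLib

/-!
# Principal units of a `ℤᵐ⁰`-valued field of residue characteristic `p` are PRO-`p`: `v(x^{p^j} − 1) ≤ q^{−(j+1)}` uniformly, and closed submonoids of
# principal units are closed under prime-to-`p` roots (Serre, *Local Fields* II §4 / IV §2; Neukirch II (3.10), (5.3)–(5.7))

Topic `NumberTheory/LocalFields`; namespace `Literature.NumberTheory.LocalFields`.  For a field `L` with a valuation `v : L → ℤᵐ⁰` (Mathlib `Valued L ℤᵐ⁰`,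
e.g. the completion `F_w` of a number field) and a rational prime `p` with `v(p) < 1`:

* §1 (pure valuation arithmetic) `valued_pow_sub_one_le` — `v(y^i − 1) ≤ v(y − 1)` for `v(y) ≤ 1`; ★ `valued_pow_prime_sub_one_le` —
  `v(y − 1) ≤ q^{−n}` (`n ≥ 1`) ⟹ `v(y^p − 1) ≤ q^{−(n+1)}` (`y^p − 1 = (y − 1)(1 + y + ⋯ + y^{p−1})` and the second factor is `≡ p` modulo `y − 1`);
  ★★ `valued_pow_prime_pow_sub_one_le` — **`v(y − 1) < 1 ⟹ v(y^{p^j} − 1) ≤ q^{−(j+1)}`**, UNIFORMLY in `y` (the principal units are pro-`p`: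
  `U^{(1)} ⊇ U^{(2)} ⊇ ⋯`, `(U^{(n)})^p ⊆ U^{(n+1)}`).
* §2 (topology) `exists_setOf_valued_sub_le_subset` — every neighbourhood of a unit `x` contains `{y | v(y − x) ≤ q^{−n}}` for some `n`;
  ★★ `mem_of_pow_mem_of_isClosed` — **a closed submonoid `H` of `L` containing `x^M`, with `v(x − 1) < 1` and `p ∤ M`, contains `x`**:
  `x = lim_j (x^M)^{a_j}` with `a_j M ≡ 1 (mod p^j)`, since `x^{1 + p^j b} − x = x·((x^{p^j})^b − 1) → 0` — closed subgroups of `U^{(1)}` are `ℤ_p`-submodules,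
  in particular uniquely divisible by prime-to-`p` integers; ★ `mem_of_forall_eq_mul_of_isClosed` — `z = h_k·w_k` with `h_k ∈ H` closed and `v(w_k − 1) ≤ q^{−(k+1)}`
  for all `k` ⟹ `z ∈ H`; ★ `valued_sub_le_of_eq_mul_pow_prime_pow` — `x = f·c^{p^k}`, `v(c − 1) < 1`, `v(x) ≤ 1` ⟹ `v(f − x) ≤ q^{−(k+1)}` (the factor `f`
  of a `p^k`-divisible factorisation is close to `x`).
These are the local inputs of the depletion step «the `p`-depleted elliptic units die in `lim←`» of de Shalit III §1.3–1.4 (cell `bsd-print-cf2`, brick (c)).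
THEOREMS ONLY (no definition, no named fact, no `sorry`, no instance).

## References
* [SerreLocalFields1979] J.-P. Serre, *Local Fields* (1979), Ch. II §4 Prop. 8, Ch. IV §2 Prop. 6 (`U^{(n)}/U^{(n+1)}`, `x ↦ x^p`).
* [NeukirchANT1999] J. Neukirch, *Algebraic Number Theory* (1999), Ch. II §3 (3.10), §5 (5.3)–(5.7) (`U^{(1)}` is a `ℤ_p`-module).
-/

noncomputable section

open scoped Topology
open WithZero MonoidWithZeroHom MonoidWithZeroHom.ValueGroup₀ Finset

namespace Literature.NumberTheory.LocalFields

section Arithmetic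

variable {L : Type*} [Field L] [Valued L ℤᵐ⁰]

/-- `v(y^i − 1) ≤ v(y − 1)` for `v(y) ≤ 1`. [cite: SerreLocalFields1979, Ch. IV §2 Prop. 6] -/
theorem valued_pow_sub_one_le {y : L} (hy : Valued.v y ≤ 1) (i : ℕ) : Valued.v (y ^ i - 1) ≤ Valued.v (y - 1) := by
  induction i with
  | zero => simp
  | succ i ih =>
    have e : y ^ (i + 1) - 1 = y * (y ^ i - 1) + (y - 1) := by ring
    rw [e]
    refine (Valuation.map_add _ _ _).trans (max_le ?_ le_rfl)
    rw [Valuation.map_mul]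
    calc Valued.v y * Valued.v (y ^ i - 1) ≤ 1 * Valued.v (y - 1) := mul_le_mul' hy ih
      _ = Valued.v (y - 1) := one_mul _

/-- `v(y) = 1` for a principal unit (`v(y − 1) < 1`). [cite: SerreLocalFields1979, Ch. II §4] -/
theorem valued_eq_one_of_valued_sub_one_lt_one' {y : L} (hy : Valued.v (y - 1) < 1) : Valued.v y = 1 := by
  have h := Valuation.map_add_eq_of_lt_left (Valued.v) (x := (1 : L)) (y := y - 1) (by rw [Valuation.map_one]; exact hy)
  rwa [add_sub_cancel, Valuation.map_one] at h

/-- In `ℤᵐ⁰`: `γ < 1 ↔ γ ≤ exp(−1)`. [cite: NeukirchANT1999, Ch. II §3 (3.10)] -/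
theorem lt_one_iff_le_exp_neg_one (γ : ℤᵐ⁰) : γ < 1 ↔ γ ≤ exp (-1 : ℤ) := by
  have h := WithZero.lt_mul_exp_iff_le (x := γ) (y := exp (-1 : ℤ)) (exp_ne_zero)
  rw [← exp_add, show (-1 : ℤ) + 1 = 0 by norm_num, exp_zero] at h
  exact h

/-- `1 + y + ⋯ + y^{p−1}` has valuation `≤ max(v(p), v(y − 1))` for `v(y) ≤ 1` (it is `≡ p` modulo `y − 1`). [cite: SerreLocalFields1979, Ch. IV §2 Prop. 6] -/
theorem valued_geom_sum_le {y : L} (hy : Valued.v y ≤ 1) (p : ℕ) :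
    Valued.v (∑ i ∈ range p, y ^ i) ≤ max (Valued.v (p : L)) (Valued.v (y - 1)) := by
  have e : ∑ i ∈ range p, y ^ i = (∑ i ∈ range p, (y ^ i - 1)) + (p : L) := by
    rw [Finset.sum_sub_distrib]; simp
  rw [e]
  refine (Valuation.map_add _ _ _).trans ?_
  rw [max_comm]
  refine max_le_max le_rfl ?_
  exact Valuation.map_sum_le _ fun i _ ↦ valued_pow_sub_one_le hy i

/-- ★ **`v(y − 1) ≤ q^{−n}` with `n ≥ 1` and `v(p) < 1` ⟹ `v(y^p − 1) ≤ q^{−(n+1)}`.** [cite: SerreLocalFields1979, Ch. IV §2 Prop. 6]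
[cite: NeukirchANT1999, Ch. II §5 (5.5)] -/
theorem valued_pow_prime_sub_one_le {p : ℕ} (hp : Valued.v (p : L) < 1) {y : L} {n : ℕ} (hn : 1 ≤ n)
    (hy : Valued.v (y - 1) ≤ exp (-(n : ℤ))) : Valued.v (y ^ p - 1) ≤ exp (-((n + 1 : ℕ) : ℤ)) := by
  have hy1 : Valued.v (y - 1) < 1 := lt_of_le_of_lt hy (by rw [← exp_zero, exp_lt_exp]; omega)
  have hyv : Valued.v y ≤ 1 := (valued_eq_one_of_valued_sub_one_lt_one' hy1).le
  have e : y ^ p - 1 = (∑ i ∈ range p, y ^ i) * (y - 1) := (geom_sum_mul y p).symm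
  rw [e, Valuation.map_mul]
  have h1 : Valued.v (∑ i ∈ range p, y ^ i) ≤ exp (-1 : ℤ) := by
    refine (valued_geom_sum_le hyv p).trans (max_le ((lt_one_iff_le_exp_neg_one _).mp hp) ?_)
    exact hy.trans (by rw [exp_le_exp]; omega)
  calc Valued.v (∑ i ∈ range p, y ^ i) * Valued.v (y - 1) ≤ exp (-1 : ℤ) * exp (-(n : ℤ)) := mul_le_mul' h1 hy
    _ = exp (-((n + 1 : ℕ) : ℤ)) := by rw [← exp_add]; congr 1; push_cast; ring

/-- ★★ **The principal units are pro-`p`, uniformly: `v(y − 1) < 1 ⟹ v(y^{p^j} − 1) ≤ q^{−(j+1)}`** (`v(p) < 1`).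
[cite: SerreLocalFields1979, Ch. IV §2 Prop. 6] [cite: NeukirchANT1999, Ch. II §5 (5.5)–(5.7)] -/
theorem valued_pow_prime_pow_sub_one_le {p : ℕ} (hp : Valued.v (p : L) < 1) {y : L} (hy : Valued.v (y - 1) < 1) (j : ℕ) :
    Valued.v (y ^ p ^ j - 1) ≤ exp (-((j + 1 : ℕ) : ℤ)) := by
  induction j with
  | zero => simpa [pow_zero, pow_one] using (lt_one_iff_le_exp_neg_one _).mp hy
  | succ j ih =>
    rw [pow_succ, pow_mul]
    exact valued_pow_prime_sub_one_le hp (by omega) ih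

/-- `v(y^b − 1) ≤ v(y − 1)` for a principal unit and any natural exponent (restated for `v(y−1) < 1`). [cite: SerreLocalFields1979, Ch. IV §2 Prop. 6] -/
theorem valued_pow_sub_one_le_of_lt {y : L} (hy : Valued.v (y - 1) < 1) (b : ℕ) : Valued.v (y ^ b - 1) ≤ Valued.v (y - 1) :=
  valued_pow_sub_one_le (valued_eq_one_of_valued_sub_one_lt_one' hy).le b

/-- ★ **The `f` of a `p^k`-divisible factorisation is close**: `x = f·c^{p^k}` with `v(c − 1) < 1`, `v(x) ≤ 1`, `v(p) < 1` ⟹ `v(f − x) ≤ q^{−(k+1)}`.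
[cite: NeukirchANT1999, Ch. II §5 (5.5)–(5.7)] -/
theorem valued_sub_le_of_eq_mul_pow_prime_pow {p : ℕ} (hp : Valued.v (p : L) < 1) {x f c : L} (hx : Valued.v x ≤ 1) (hc : Valued.v (c - 1) < 1)
    (k : ℕ) (h : x = f * c ^ p ^ k) : Valued.v (f - x) ≤ exp (-((k + 1 : ℕ) : ℤ)) := by
  have hc1 : Valued.v c = 1 := valued_eq_one_of_valued_sub_one_lt_one' hc
  have hck : Valued.v (c ^ p ^ k) = 1 := by rw [Valuation.map_pow, hc1, one_pow]
  have hf : Valued.v f ≤ 1 := by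
    have : Valued.v x = Valued.v f := by rw [h, Valuation.map_mul, hck, mul_one]
    rw [← this]; exact hx
  have e : f - x = -(f * (c ^ p ^ k - 1)) := by rw [h]; ring
  rw [e, Valuation.map_neg, Valuation.map_mul]
  calc Valued.v f * Valued.v (c ^ p ^ k - 1) ≤ 1 * exp (-((k + 1 : ℕ) : ℤ)) := mul_le_mul' hf (valued_pow_prime_pow_sub_one_le hp hc k)
    _ = exp (-((k + 1 : ℕ) : ℤ)) := one_mul _

end Arithmetic

/-! ### §2. Topology: closed submonoids of principal units are prime-to-`p` root closed -/

section Topology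

variable {L : Type*} [Field L] [Valued L ℤᵐ⁰]

/-- Every neighbourhood of `1` contains a closed ball `{y | v(y − 1) ≤ q^{−n}}` (the `U^{(n)}` are a basis of neighbourhoods of `1`).
[cite: NeukirchANT1999, Ch. II §5 (5.3)] -/
theorem exists_setOf_valued_sub_one_le_subset {u : Set L} (hu : u ∈ 𝓝 (1 : L)) :
    ∃ n : ℕ, {y : L | Valued.v (y - 1) ≤ exp (-(n : ℤ))} ⊆ u := by
  obtain ⟨γ, hγ⟩ := Valued.mem_nhds.1 hu
  have hγ0 : embedding (γ : ValueGroup₀ (MonoidWithZeroHom.ofClass (Valued.v : Valuation L ℤᵐ⁰))) ≠ 0 := embedding_unit_ne_zero γ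
  set m : ℤ := log (embedding (γ : ValueGroup₀ (MonoidWithZeroHom.ofClass (Valued.v : Valuation L ℤᵐ⁰)))) with hm
  refine ⟨(-m).toNat + 1, fun y hy ↦ hγ ?_⟩
  rw [Set.mem_setOf_eq, Valuation.restrict_lt_iff_lt_embedding, ← exp_log hγ0, ← hm]
  refine lt_of_le_of_lt hy (exp_lt_exp.2 ?_)
  have := Int.self_le_toNat (-m)
  push_cast
  omega

/-- The same around any unit `x` (`v(x) = 1`): every neighbourhood of `x` contains `{y | v(y − x) ≤ q^{−n}}` for some `n`.
[cite: NeukirchANT1999, Ch. II §5 (5.3)] -/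
theorem exists_setOf_valued_sub_le_subset {x : L} (hx : Valued.v x = 1) {u : Set L} (hu : u ∈ 𝓝 x) :
    ∃ n : ℕ, {y : L | Valued.v (y - x) ≤ exp (-(n : ℤ))} ⊆ u := by
  have hx0 : x ≠ 0 := fun h0 ↦ by rw [h0, Valuation.map_zero] at hx; exact zero_ne_one hx
  -- pull back along the homeomorphism `y ↦ x * y`
  have hcont : Continuous fun y : L ↦ x * y := continuous_const.mul continuous_id
  have hu' : (fun y : L ↦ x * y) ⁻¹' u ∈ 𝓝 (1 : L) := hcont.continuousAt.preimage_mem_nhds (by rwa [mul_one])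
  obtain ⟨n, hn⟩ := exists_setOf_valued_sub_one_le_subset hu'
  refine ⟨n, fun y hy ↦ ?_⟩
  have hmem : x⁻¹ * y ∈ {y : L | Valued.v (y - 1) ≤ exp (-(n : ℤ))} := by
    rw [Set.mem_setOf_eq, show x⁻¹ * y - 1 = x⁻¹ * (y - x) by rw [mul_sub, inv_mul_cancel₀ hx0], Valuation.map_mul, map_inv₀, hx, inv_one,
      one_mul]
    exact hy
  have := hn hmem
  simpa [Set.mem_preimage, mul_inv_cancel_left₀ hx0] using this

/-- ★ **Limits of `H`-translates by shrinking principal units stay in `H`**: if `H` is closed and for every `k` we have `z = h_k · w_k` with `h_k ∈ H`,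
`v(h_k) ≤ 1` and `v(w_k − 1) ≤ q^{−(k+1)}`, then `z ∈ H`. [cite: NeukirchANT1999, Ch. II §5 (5.3)] -/
theorem mem_of_forall_eq_mul_of_isClosed {H : Set L} (hH : IsClosed H) {z : L} (hz : Valued.v z = 1)
    (h : ∀ k : ℕ, ∃ hk ∈ H, ∃ w : L, Valued.v (w - 1) ≤ exp (-((k + 1 : ℕ) : ℤ)) ∧ z = hk * w) : z ∈ H := by
  rw [← hH.closure_eq, mem_closure_iff_nhds]
  intro u hu
  obtain ⟨n, hn⟩ := exists_setOf_valued_sub_le_subset hz hu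
  obtain ⟨hk, hhk, w, hw, e⟩ := h n
  refine ⟨hk, hn ?_, hhk⟩
  rw [Set.mem_setOf_eq]
  have hw1 : Valued.v (w - 1) < 1 := lt_of_le_of_lt hw (by rw [← exp_zero, exp_lt_exp]; omega)
  have hwv : Valued.v w = 1 := valued_eq_one_of_valued_sub_one_lt_one' hw1
  have hw0 : w ≠ 0 := fun h0 ↦ by rw [h0, Valuation.map_zero] at hwv; exact zero_ne_one hwv
  have hhkv : Valued.v hk = 1 := by
    have := congrArg Valued.v e
    rw [Valuation.map_mul, hz, hwv, mul_one] at this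
    exact this.symm
  have e' : hk - z = -(hk * (w - 1)) := by rw [e]; ring
  rw [e', Valuation.map_neg, Valuation.map_mul, hhkv, one_mul]
  exact hw.trans (by rw [exp_le_exp]; push_cast; omega)

/-- ★★ **Closed submonoids of the principal units are closed under prime-to-`p` roots**: `H ⊆ L` closed and closed under products, `x^M ∈ H` with
`v(x − 1) < 1`, `p ∤ M`, `v(p) < 1` (`p` prime) ⟹ `x ∈ H`.  (`x = lim_j (x^M)^{a_j}`, `a_j M ≡ 1 (mod p^j)`: the closed subgroups of `U^{(1)}` are
`ℤ_p`-submodules.) [cite: NeukirchANT1999, Ch. II §5 (5.7)] [cite: SerreLocalFields1979, Ch. II §4 Prop. 8] -/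
theorem mem_of_pow_mem_of_isClosed {p : ℕ} (hpp : p.Prime) (hp : Valued.v (p : L) < 1) (H : Submonoid L) (hH : IsClosed (H : Set L))
    {x : L} (hx : Valued.v (x - 1) < 1) {M : ℕ} (hM : ¬ p ∣ M) (hxM : x ^ M ∈ H) : x ∈ H := by
  have hxv : Valued.v x = 1 := valued_eq_one_of_valued_sub_one_lt_one' hx
  rw [← SetLike.mem_coe]
  refine mem_of_forall_eq_mul_of_isClosed hH hxv fun k ↦ ?_
  -- `a M ≡ 1 (mod p^(k+1))`
  have hcop : Nat.Coprime M (p ^ (k + 1)) := (Nat.Coprime.pow_right _ ((Nat.Prime.coprime_iff_not_dvd hpp).mpr hM).symm)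
  obtain ⟨a, ha⟩ := Nat.exists_mul_mod_eq_one_of_coprime hcop (Nat.one_lt_pow (Nat.succ_ne_zero k) hpp.one_lt)
  -- `M a = 1 + p^(k+1) b`
  obtain ⟨b, hb⟩ : ∃ b : ℕ, M * a = 1 + p ^ (k + 1) * b := by
    refine ⟨M * a / p ^ (k + 1), ?_⟩
    have := Nat.mod_add_div (M * a) (p ^ (k + 1))
    rw [ha.2] at this
    omega
  -- the correcting principal unit `y = (x^{p^{k+1}})^b` and `w = y⁻¹`
  set y : L := (x ^ p ^ (k + 1)) ^ b with hy
  have h1 : Valued.v (x ^ p ^ (k + 1) - 1) ≤ exp (-((k + 1 + 1 : ℕ) : ℤ)) := valued_pow_prime_pow_sub_one_le hp hx (k + 1)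
  have h2 : Valued.v (x ^ p ^ (k + 1) - 1) < 1 := lt_of_le_of_lt h1 (by rw [← exp_zero, exp_lt_exp]; omega)
  have hy1 : Valued.v (y - 1) ≤ exp (-((k + 1 : ℕ) : ℤ)) :=
    (valued_pow_sub_one_le_of_lt h2 b).trans (h1.trans (by rw [exp_le_exp]; push_cast; omega))
  have hy1' : Valued.v (y - 1) < 1 := lt_of_le_of_lt hy1 (by rw [← exp_zero, exp_lt_exp]; omega)
  have hyv : Valued.v y = 1 := valued_eq_one_of_valued_sub_one_lt_one' hy1'
  have hy0 : y ≠ 0 := fun h0 ↦ by rw [h0, Valuation.map_zero] at hyv; exact zero_ne_one hyv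
  refine ⟨(x ^ M) ^ a, pow_mem hxM a, y⁻¹, ?_, ?_⟩
  · rw [show y⁻¹ - 1 = -(y⁻¹ * (y - 1)) by rw [mul_sub, inv_mul_cancel₀ hy0]; ring, Valuation.map_neg, Valuation.map_mul, map_inv₀, hyv,
      inv_one, one_mul]
    exact hy1
  · have e : (x ^ M) ^ a = x * y := by rw [hy, ← pow_mul x M a, hb, pow_add, pow_one, pow_mul]
    rw [e, mul_assoc, mul_inv_cancel₀ hy0, mul_one]

end Topology

end Literature.NumberTheory.LocalFields

end
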